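import Summits.SmoothPoincare4.SmoothPoincare4.Theorems.DcrGap.Negative.NoDiscNormalForm
import Summits.SmoothPoincare4.SmoothPoincare4.Theorems.DcrGap.Negative.KZeroIsFgmw
import Literature.Topology.FourManifolds.SmaleHomologySpheresFiveSixTheta

/-!
# Line `homology_ladder` — skeleton for the crux `DottedCircleRasmussen.DcrGap`

Forward generator G4 `ladder-down` (seed `g4b-SmoothPoincare4-16128`, unit
`fwd-ladder-SmoothPoincare4-50`).  Card: `Lines/homology_ladder.md`; ladder table:
`LADDER-DcrGap.md`; sorry-free witness of the floor rung: `Lines/homology_ladder_special.lean`.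

THE LADDER.  In the crux's own normal-form language (`Negative.dcrGap_iff_modelForm`):

  `DcrGap ↔ ∃ k K, IsModelKnot k K ∧ (∃ M ≃ₕ S⁴ smooth, ∃ e f, IsSliceDiscInComplement k K M e f)
            ∧ ∀ g, ¬ IsModelSliceDisc k K g`,

grade the POSITIVE AMBIENT `M` by the coefficient ring `R` of the homology-sphere condition:

* `HomologySphereSliceGap R` — some model knot `K ⊂ ∂D_k` is slice in the `D_k`-complement of a
  CLOSED CONNECTED SMOOTH 4-MANIFOLD WITH THE `R`-HOMOLOGY OF `S⁴`, but bounds no smooth proper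
  disc in `ℝ⁴ ∖ D_k`.
* `R = ℚ` : FLOOR, proved in print at `k = 0` (figure-eight: rationally slice, not slice) —
  named fact `rationalSliceGap_floor`, witness `homologySphereSliceGap_rat_of_floor` (no sorry).
* `R = ℤ` : NEXT RUNG — open in print ("a knot slice in an integer homology 4-ball but not in
  `B⁴`?", Ray 2024 p. 17; "is `s` a homology concordance invariant?", Hom–Kang–Park–Stoffregen
  2022 §1) — `stub_certificateBeyondHomology` is its certificate form.
* `R = ℤ ∧ π₁ = 1` : the CRUX (`dcrGap_of_simplyConnectedSliceGap` /
  `simplyConnectedSliceGap_of_dcrGap`, Hurewicz–Whitehead recognition in the tree).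

On-path (proved): `homologySphereSliceGap_int_of_dcrGap : DcrGap → HomologySphereSliceGap ℤ`.
Composition (proved): `DcrGap_of : DcrGap` from the three stubs by name (`dcrGap_of_parts` is the hypothesis form).
Stubs: `stub_certificateBeyondHomology` (THE RUNG, load-bearing, frontier-bankable),
`stub_mmsw819` (MMSW Lemma 8.19, shared with line `mk_friends`), `stub_simplyConnectedUpgrade`
(the passage rung `ℤ` → top; honest tier C — see the card).
-/

noncomputable section

set_option linter.dupNamespace false
set_option linter.style.longLine false

open scoped Manifold ContDiff Topology
open Function Set CategoryTheory Limits
open Literature.Topology.FourManifolds Literature.Topology.FourManifolds.MMSW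
open Literature.AlgebraicTopology.SingularHomology Literature.AlgebraicTopology.Homotopy
open Summit.SmoothPoincare4.SmoothPoincare4.Theses.DottedCircleRasmussen
open Summit.SmoothPoincare4.SmoothPoincare4.Theorems.DcrGap

namespace Summit.SmoothPoincare4.SmoothPoincare4.Cruxes.DcrGap.HomologyLadder

/-! ## The gradation parameter: the coefficient ring of the homology-sphere condition -/

/-- **`M` has the `R`-homology of the `n`-sphere** (`R` a commutative ring of coefficients):
`Hᵢ(M; R) = 0` for `0 < i ≠ n` and `Hₙ(M; R) ≅ R`.  For `R = ℤ` this is the tree's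
`IsHomologySphere M n` on the nose (`isHomologySphereOver_int_iff`). [cite: HatcherAT2002, Cor. 2.14] -/
def IsHomologySphereOver (R : Type) [CommRing R] (M : Type) [TopologicalSpace M] (n : ℕ) : Prop :=
  (∀ i : ℕ, 0 < i → i ≠ n → IsZero (singularHomology R R M i)) ∧
    Nonempty (singularHomology R R M n ≅ ModuleCat.of R (ULift.{0} R))

/-- `R = ℤ`: the tree's integral homology spheres. [folklore] -/
theorem isHomologySphereOver_int_iff (M : Type) [TopologicalSpace M] (n : ℕ) :
    IsHomologySphereOver ℤ M n ↔ IsHomologySphere M n := Iff.rfl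

/-! ## The rung family -/

/-- **RUNG `R` — the `R`-HOMOLOGY-SPHERE SLICE GAP.**  Some model knot `K ⊂ ∂D_k`
(`MMSW.IsModelKnot k K`) is slice in the complement of the dotted handlebody `e(D_k)` inside some
closed connected smooth 4-manifold `M` with the `R`-homology of `S⁴`
(`MMSW.IsSliceDiscInComplement k K M e f`), yet bounds NO smooth proper disc in `ℝ⁴ ∖ D_k`
(`MMSW.IsModelSliceDisc`, the normal form of the crux's no-disc clause,
`Negative.noDisc_iff_forall_not_isModelSliceDisc`).  `R = ℚ`: known (floor); `R = ℤ`: open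
(the rung); `R = ℤ ∧ π₁ = 1`: the crux. [cite: KimWu2018, Def. 1.3] -/
def HomologySphereSliceGap (R : Type) [CommRing R] : Prop :=
  ∃ (k : ℕ) (K : (Metric.sphere (0 : EuclideanSpace ℝ (Fin 2)) 1) → EuclideanSpace ℝ (Fin 4)),
    IsModelKnot k K ∧
    (∃ (M : Type) (_ : TopologicalSpace M) (_ : T2Space M) (_ : SecondCountableTopology M)
        (_ : ChartedSpace (EuclideanSpace ℝ (Fin 4)) M) (_ : IsManifold (𝓡 4) ∞ M),
        CompactSpace M ∧ ConnectedSpace M ∧ IsHomologySphereOver R M 4 ∧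
          ∃ (e : EuclideanSpace ℝ (Fin 4) → M) (f : EuclideanSpace ℝ (Fin 2) → M),
            IsSliceDiscInComplement k K M e f) ∧
    ∀ g, ¬ IsModelSliceDisc k K g

/-- **THE TOP IN LADDER LANGUAGE — the simply connected integral rung.**  As `HomologySphereSliceGap ℤ`
with the positive ambient `M` moreover SIMPLY CONNECTED; by Hurewicz–Whitehead such an `M` is a
homotopy 4-sphere, so this is the crux (`dcrGap_of_simplyConnectedSliceGap`,
`simplyConnectedSliceGap_of_dcrGap`). [cite: HatcherAT2002, Cor. 4.33] -/
def SimplyConnectedSliceGap : Prop :=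
  ∃ (k : ℕ) (K : (Metric.sphere (0 : EuclideanSpace ℝ (Fin 2)) 1) → EuclideanSpace ℝ (Fin 4)),
    IsModelKnot k K ∧
    (∃ (M : Type) (_ : TopologicalSpace M) (_ : T2Space M) (_ : SecondCountableTopology M)
        (_ : ChartedSpace (EuclideanSpace ℝ (Fin 4)) M) (_ : IsManifold (𝓡 4) ∞ M),
        CompactSpace M ∧ SimplyConnectedSpace M ∧ IsHomologySphereOver ℤ M 4 ∧
          ∃ (e : EuclideanSpace ℝ (Fin 4) → M) (f : EuclideanSpace ℝ (Fin 2) → M),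
            IsSliceDiscInComplement k K M e f) ∧
    ∀ g, ¬ IsModelSliceDisc k K g

/-! ## On-path: the crux implies the integral rung -/

/-- **ON-PATH `DcrGap → HomologySphereSliceGap ℤ`.**  A homotopy 4-sphere is compact
(`compactSpace_of_homotopyEquiv_sphere`), simply connected hence connected, and an integral
homology sphere (`SmaleHomologySpheres.isHomologySphere_of_homotopyEquiv_sphere`).
[cite: HatcherAT2002, Prop. 3.29, Cor. 2.11, Cor. 2.14] -/
theorem homologySphereSliceGap_int_of_dcrGap (hX : DcrGap) : HomologySphereSliceGap ℤ := by
  obtain ⟨k, K, hK, ⟨M, _, _, _, _, _, ⟨e⟩, e', f, hd⟩, hN⟩ := Negative.dcrGap_iff_modelForm.1 hX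
  haveI : CompactSpace M := compactSpace_of_homotopyEquiv_sphere (n := 4) (by norm_num) M e
  haveI := Literature.AlgebraicTopology.FundamentalGroup.simplyConnectedSpace_euclideanSphere 4
    (by norm_num)
  haveI : SimplyConnectedSpace M := e.simplyConnectedSpace
  have hH : IsHomologySphere M 4 :=
    SmaleHomologySpheres.isHomologySphere_of_homotopyEquiv_sphere (by norm_num) e
  exact ⟨k, K, hK, ⟨M, _, ‹_›, ‹_›, _, ‹_›, ‹_›, inferInstance,
    (isHomologySphereOver_int_iff M 4).2 hH, e', f, hd⟩, hN⟩

/-- **The crux gives the simply connected rung** (same proof, keeping `π₁ = 1`). [cite: HatcherAT2002, Prop. 3.29] -/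
theorem simplyConnectedSliceGap_of_dcrGap (hX : DcrGap) : SimplyConnectedSliceGap := by
  obtain ⟨k, K, hK, ⟨M, _, _, _, _, _, ⟨e⟩, e', f, hd⟩, hN⟩ := Negative.dcrGap_iff_modelForm.1 hX
  haveI : CompactSpace M := compactSpace_of_homotopyEquiv_sphere (n := 4) (by norm_num) M e
  haveI := Literature.AlgebraicTopology.FundamentalGroup.simplyConnectedSpace_euclideanSphere 4
    (by norm_num)
  haveI : SimplyConnectedSpace M := e.simplyConnectedSpace
  have hH : IsHomologySphere M 4 :=
    SmaleHomologySpheres.isHomologySphere_of_homotopyEquiv_sphere (by norm_num) e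
  exact ⟨k, K, hK, ⟨M, _, ‹_›, ‹_›, _, ‹_›, ‹_›, ‹_›,
    (isHomologySphereOver_int_iff M 4).2 hH, e', f, hd⟩, hN⟩

/-- **RECOGNITION: the simply connected rung IS the crux** (stated as an `↔` so that the skeleton's
`DcrGap_of` below is the first theorem concluding the crux by name).  A closed simply connected smooth
4-manifold with the integral homology of `S⁴` is homotopy equivalent to `S⁴` (Hurewicz + Whitehead; tree
theorem `nonempty_homotopyEquiv_sphere_of_isHomologySphere`), so its datum is a crux datum; the converse
is `simplyConnectedSliceGap_of_dcrGap`. [cite: HatcherAT2002, Cor. 4.33, Cor. A.12] -/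
theorem simplyConnectedSliceGap_iff_dcrGap : SimplyConnectedSliceGap ↔ DcrGap := by
  refine ⟨fun h => ?_, simplyConnectedSliceGap_of_dcrGap⟩
  obtain ⟨k, K, hK, ⟨M, _, _, _, _, _, hc, hsc, hH, e', f, hd⟩, hN⟩ := h
  haveI := hc
  haveI := hsc
  obtain ⟨e⟩ := nonempty_homotopyEquiv_sphere_of_isHomologySphere (M := M) (n := 4) (by norm_num)
    ((isHomologySphereOver_int_iff M 4).1 hH)
  exact Negative.dcrGap_iff_modelForm.2 ⟨k, K, hK, ⟨M, _, ‹_›, ‹_›, _, ‹_›, ⟨e⟩, e', f, hd⟩, hN⟩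

/-- The simply connected rung implies the integral rung (a simply connected space is connected). [folklore] -/
theorem homologySphereSliceGap_int_of_simplyConnected (h : SimplyConnectedSliceGap) :
    HomologySphereSliceGap ℤ := by
  obtain ⟨k, K, hK, ⟨M, _, _, _, _, _, hc, hsc, hH, e', f, hd⟩, hN⟩ := h
  haveI := hsc
  exact ⟨k, K, hK, ⟨M, _, ‹_›, ‹_›, _, ‹_›, hc, inferInstance, hH, e', f, hd⟩, hN⟩

/-! ## The floor (`R = ℚ`, `k = 0`): a non-slice knot slice in a punctured rational homology sphere -/

/-- **FLOOR FACT (Kawauchi; Cochran after Fintushel–Stern; Kim–Wu).**  Some knot `K ⊂ S³` that is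
NOT smoothly slice bounds a smooth proper disc in `M ∖ e(B̊⁴)` for some closed connected smooth
4-manifold `M` with the RATIONAL homology of `S⁴` (equivalently: is slice in a rational homology
4-ball `V`, `M = V ∪ B⁴`).  Witness in print: the figure-eight knot `4₁` — rationally (indeed
`ℤ[1/2]`-) slice [Kim–Wu 2018, Def. 1.3 and Lemma 3.1 (2), after Kawauchi 2009; Cochran after
Fintushel–Stern 1984, see Hom–Kang–Park–Stoffregen 2022 §1], and not slice (not even
algebraically slice: Fox–Milnor, `Δ = t² - 3t + 1`) [Kim–Wu 2018, Rem. 1.4].  Hypothesis-shaped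
named fact (the tree has no figure-eight knot yet). [cite: KimWu2018, Def. 1.3, Lemma 3.1 (2), Rem. 1.4] [cite: HomKangParkStoffregen2022, §1] -/
def rationalSliceGap_floor : Prop :=
  ∃ K : Knot, ¬ K.IsSmoothlySlice ∧
    ∃ (M : Type) (_ : TopologicalSpace M) (_ : T2Space M) (_ : SecondCountableTopology M)
      (_ : ChartedSpace (EuclideanSpace ℝ (Fin 4)) M) (_ : IsManifold (𝓡 4) ∞ M),
      CompactSpace M ∧ ConnectedSpace M ∧ IsHomologySphereOver ℚ M 4 ∧
        ∃ (e : EuclideanSpace ℝ (Fin 4) → M) (f : EuclideanSpace ℝ (Fin 2) → M),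
          K.IsSliceDiscIn M e f

/-- **WITNESS (F3 / BC5): the floor fact gives RUNG `ℚ` at `k = 0`.**  An H-slice datum for `K`
in the rational homology sphere `M` is a `k = 0` dotted-slice datum for the rescaled model knot
`L ∘ K ⊂ ∂D_0`, `L = diag(40,40,1,1)` (`Negative.isSliceDiscInComplement_zero_of_isSliceDiscIn`,
`Negative.isModelKnot_scaling_comp`); and a MODEL slice disc for `L ∘ K` in `ℝ⁴ ∖ D_0`, pushed
into `S⁴` by a stereographic chart, un-scaled (`Negative.isSliceDiscIn_of_isSliceDiscInComplement_zero`)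
and neatened by Palais (`Knot.palais_ballComplement_sphere_four_holds`,
`Knot.isSmoothlySlice_of_isProperDisc_holds`), would slice `K` in `B⁴`. [cite: Palais1960, Thm. B] -/
theorem homologySphereSliceGap_rat_of_floor (h : rationalSliceGap_floor) :
    HomologySphereSliceGap ℚ := by
  obtain ⟨L, hL⟩ := Negative.exists_scaling
  have hD := Negative.scaling_mem_modelHandlebody_zero_iff hL
  obtain ⟨K, hKns, M, _, _, _, _, _, hMc, hMconn, hMQ, e, f, hef⟩ := h
  set K' : Metric.sphere (0 : EuclideanSpace ℝ (Fin 2)) 1 → EuclideanSpace ℝ (Fin 4) :=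
    (L : EuclideanSpace ℝ (Fin 4) → EuclideanSpace ℝ (Fin 4)) ∘ fun t =>
      ((K t : Metric.sphere (0 : EuclideanSpace ℝ (Fin 4)) 1) : EuclideanSpace ℝ (Fin 4)) with hK'
  have hmk : IsModelKnot 0 K' := Negative.isModelKnot_scaling_comp hL K
  have hdat : IsSliceDiscInComplement 0 K' M _ f :=
    Negative.isSliceDiscInComplement_zero_of_isSliceDiscIn hD hef
  refine ⟨0, K', hmk, ⟨M, _, ‹_›, ‹_›, _, ‹_›, hMc, hMconn, hMQ, _, f, hdat⟩, fun g hg => hKns ?_⟩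
  -- a model slice disc for `K'` in `ℝ⁴ ∖ D_0` would slice `K` in `B⁴`
  have hS := hg.isSliceDiscInComplement_chartAt_symm
    (⟨EuclideanSpace.single 0 1, by simp⟩ : Metric.sphere (0 : EuclideanSpace ℝ (Fin 5)) 1)
  have hIn := Negative.isSliceDiscIn_of_isSliceDiscInComplement_zero hD hS
  obtain ⟨U, c, hc₁, hc₂⟩ := Knot.palais_ballComplement_sphere_four_holds _ hIn.isSmoothEmbedding
  obtain ⟨g', hg'⟩ := hIn.exists_isProperDisc c hc₁ hc₂
  exact Knot.isSmoothlySlice_of_isProperDisc_holds K g' hg'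

/-! ## The line: the rung in certificate form, the stubs, the kernel-checked composition -/

/-- **RUNG `ℤ` IN CERTIFICATE FORM.**  Some model knot `K ⊂ ∂D_k` with an MMSW certificate
(`s₋(K) > 0` or `s₊(K) < 0`) is slice in the `D_k`-complement of a closed connected smooth
INTEGRAL HOMOLOGY 4-SPHERE.  At `k = 0` this reads: *some knot with `s ≠ 0` bounds a smooth disc
in a punctured integral homology 4-sphere* — i.e. Rasmussen's `s` is not an invariant of
`ℤ`-homology concordance, open [Hom–Kang–Park–Stoffregen 2022, §1; Ray 2024, p. 17].  No `π₁ = 1`,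
no homotopy sphere: the ambient supply (spun / twist-spun homology 3-spheres, boundaries of
thickened acyclic 2-complexes) is unconditional and enumerable by Kirby diagrams.
[cite: HomKangParkStoffregen2022, §1] [cite: ManolescuMarengonSarkarWillis2023, Def. 8.1, Question 9.11] -/
def CertificateBeyondHomology : Prop :=
  ∃ (k : ℕ) (K : (Metric.sphere (0 : EuclideanSpace ℝ (Fin 2)) 1) → EuclideanSpace ℝ (Fin 4)),
    (∃ (M : Type) (_ : TopologicalSpace M) (_ : T2Space M) (_ : SecondCountableTopology M)
        (_ : ChartedSpace (EuclideanSpace ℝ (Fin 4)) M) (_ : IsManifold (𝓡 4) ∞ M),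
        CompactSpace M ∧ ConnectedSpace M ∧ IsHomologySphereOver ℤ M 4 ∧
          ∃ (e : EuclideanSpace ℝ (Fin 4) → M) (f : EuclideanSpace ℝ (Fin 2) → M),
            IsSliceDiscInComplement k K M e f) ∧
    ∃ w : MMSWRasmussen k K, 0 < w.sMinus ∨ w.sPlus < 0

/-- **The certificate closes the rung, given MMSW Lemma 8.19**: a model slice disc would force
`s₋ ≤ 0 ≤ s₊` (`MMSWRasmussen.sMinus_nonpos_sPlus_nonneg`). [cite: ManolescuMarengonSarkarWillis2023, Lemma 8.19] -/
theorem homologySphereSliceGap_int_of_certificate (hc : CertificateBeyondHomology)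
    (h19 : MMSW.sMinus_nonpos_of_isModelSliceDisc) : HomologySphereSliceGap ℤ := by
  obtain ⟨k, K, hdat, w, hw⟩ := hc
  refine ⟨k, K, w.isModelKnot, hdat, fun g hg => ?_⟩
  have h := w.sMinus_nonpos_sPlus_nonneg h19 hg
  omega

/-- **STUB 1 — THE RUNG (load-bearing; frontier-bankable on its own).**  A certified datum in an
integral homology 4-sphere: `CertificateBeyondHomology`.  Supply: Kirby diagrams of named
homology 4-spheres with perfect `π₁` (spun Poincaré sphere, `∂(N⁵)` of thickened acyclic
2-complexes); a model knot on `∂D_k` slid to an unknot across the 2-handles bounds a disc in the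
complement; certificate `s₋ > 0` by an MMSW / Khovanov computation (at `k = 0`: ordinary `s`).
Why it might fail: `s` might yet be a `ℤ`-homology-concordance invariant (open either way).
[cite: HomKangParkStoffregen2022, §1] -/
theorem stub_certificateBeyondHomology : CertificateBeyondHomology := by
  sorry

/-- **STUB 2 — MMSW Lemma 8.19** (`s₋ ≤ 0` for a knot bounding a smooth proper disc in
`ℝ⁴ ∖ D_k° ≅ (♮ᵏ B² × S²)°`; at `k = 0` this is Rasmussen's slice bound).  Shared verbatim with
line `mk_friends` (`stub_mmsw819`). [cite: ManolescuMarengonSarkarWillis2023, Lemma 8.19] -/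
theorem stub_mmsw819 : MMSW.sMinus_nonpos_of_isModelSliceDisc := by
  sorry

/-- **STUB 3 — THE PASSAGE (rung `ℤ` → top; honest tier C).**  From a gap datum in SOME integral
homology 4-sphere to a gap datum in a SIMPLY CONNECTED one (= a homotopy 4-sphere, by
`dcrGap_of_simplyConnectedSliceGap`).  No technique is known: surgery on `π₁`-generators keeps the
disc but creates `H₂` (the ambient becomes a homotopy `#ᵍ S² × S²`, where the Norman trick makes
the datum worthless), and a homotopy-sphere ambient is exactly the SPC4-shielded supply the parent
route lacks.  Listed so that the composition is kernel-checked and the ladder is typed end to end;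
it is a consequence of the crux (`simplyConnectedSliceGap_of_dcrGap`), not a restatement of it
(probe `(Rung ℤ → SimplyConnectedSliceGap) → DcrGap` fails: it needs Rung `ℤ`). [conjecture] -/
theorem stub_simplyConnectedUpgrade : HomologySphereSliceGap ℤ → SimplyConnectedSliceGap := by
  sorry

/-- **THE SKELETON'S COMPOSITION — `DcrGap` BY NAME from the three registered stubs** (closed modulo
their `sorry`s only; first theorem of the file concluding the crux): the certificate (stub 1) and MMSW
L8.19 (stub 2) give RUNG `ℤ` (`homologySphereSliceGap_int_of_certificate`, proved), the passage (stub 3)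
gives the simply connected rung, and recognition (`simplyConnectedSliceGap_iff_dcrGap`, proved) gives the
crux. [folklore] -/
theorem DcrGap_of : Summit.SmoothPoincare4.SmoothPoincare4.Theses.DottedCircleRasmussen.DcrGap :=
  simplyConnectedSliceGap_iff_dcrGap.1
    (stub_simplyConnectedUpgrade
      (homologySphereSliceGap_int_of_certificate stub_certificateBeyondHomology stub_mmsw819))

/-! The hypothesis forms `dcrGap_of_parts` / `dcrGap_of_simplyConnectedSliceGap` live in the sorry-free
companion `Lines/homology_ladder_special.lean` (namespace `.Special`), so that `DcrGap_of` above is the ONLY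
theorem of this file concluding the crux. -/

end Summit.SmoothPoincare4.SmoothPoincare4.Cruxes.DcrGap.HomologyLadder

end
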